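import Summits.FinalStateConjecture.FinalStateConjecture.Theorems.EIHFluxBalanceInertialRecessionStubSlavingHelpers
import Literature.Geometry.Lorentzian.SchwarzschildKerrSchildRicciFlat
import Literature.Geometry.Lorentzian.KerrDataProofs
import Literature.Geometry.Lorentzian.KerrSchildCoord
import Literature.Geometry.Lorentzian.MultiCentreKerrSchild

/-!
# Route EIHFluxBalance — `InertialRecession`, line `sublinear-is-free-clean-window-charges`:
# the zero set of the slaving map, `a = 0` (for the slaving stub `stub_slaving`)

Helper file for the crux `stmt-FinalStateConjecture-10166`
(`Summit.FinalStateConjecture.FinalStateConjecture.Theses.EIHFluxBalance.InertialRecession`),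
stub `stub_slaving`. The slaving statement says that the crux hypothesis forces the jets
`(u̇ᵢ, ξ̇ᵢ − v(Λᵢ), …)` of the painted moduli to decay; its mechanism is that the coordinate Ricci
form of the frozen ansatz vanishes EXACTLY at inertial jets and is coercive off them. This file
proves the first half for Schwarzschild holes, unconditionally:

* the hypothesis class `[Kerr.Facts]` of the bundled Kerr metric holds (all three fields are
  theorems of the tree, cf. `SwallowTheDatum.kerrFacts`), so the Schwarzschild Ricci-flatness
  theorem `Kerr.ricci_smoothMetric_zero_spin` is available without hypotheses (instantiated inline);
* `ricAt_kerr_bilin_zero_spin` — **`ricAt (g_{M,0}) x = 0`** for `r(x) > 0`, the coordinate form;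
* `isMetricOn_kerr_bilin`, `isCoordChangeOn_poincareInv`, `pullMetric_kerr_bilin_poincareInv` —
  the painted summand `boostedKerrBilin Λ c M a` is the pull-back of the Kerr–Schild components by
  the affine map `x ↦ Λ⁻¹(x − c)`, a change of coordinates onto `{r > 0}`;
* `ricAt_boostedKerrBilin_zero_spin` — **every stationary painted Schwarzschild summand is
  Ricci-flat in the lab chart** (`ricAt_pullMetric`, file `…StubSlavingHelpers`);
* `ricAt_inertialSummand_zero_spin` — **so is the crux's summand painted with CONSTANT `Λ` and
  the INERTIAL centre `ξ(s) = ξ₀ + (s − s₀) v(Λ)`** (`boostedKerrBilin_inertialCentre`): zero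
  slaving error ⇒ `Ric = 0`. (Rotating holes need the named fact `Kerr.isRicciFlat M a r₀`,
  `a ≠ 0`, not yet a theorem of the tree.)
-/

set_option linter.dupNamespace false
set_option maxSynthPendingDepth 3

noncomputable section

open scoped Topology Manifold ContDiff
open Filter Set Function TopologicalSpace Literature.Geometry.Lorentzian
  Summit.FinalStateConjecture.FinalStateConjecture.Theorems

namespace Summit.FinalStateConjecture.FinalStateConjecture.Theorems.SublinearIsFree.Slaving

/-- **The Schwarzschild Kerr–Schild components have vanishing coordinate Ricci form**:
`ricAt (g_{M,0}) x = 0` wherever `r(x) > 0` (Kerr–Schild 1965, §3, through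
`Kerr.ricci_smoothMetric_zero_spin` and `OpensChart.ricci_eq_ricAt`). [folklore] -/
theorem ricAt_kerr_bilin_zero_spin (M : ℝ) {x : E4} (hx : 0 < Kerr.radius 0 x) (Y Z : E4) :
    MetricCoord.ricAt (Kerr.bilin M 0) x Y Z = 0 := by
  haveI : Kerr.Facts :=
    ⟨Kerr.isConnected_region_holds, Kerr.contMDiff_bilin_holds, Kerr.contMDiff_timeVector_holds⟩
  have hx' : x ∈ Kerr.region 0 0 := by
    rw [Kerr.mem_region, max_self]
    exact hx
  haveI := (Kerr.smoothMetric M 0 0).toPseudoRiemannianMetric.hasLeviCivita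
  have h1 := OpensChart.ricci_eq_ricAt (g := (Kerr.smoothMetric M 0 0).toPseudoRiemannianMetric)
    (G := Kerr.bilin M 0) (fun y ↦ Kerr.smoothMetric_val M 0 0 y) ⟨x, hx'⟩ Y Z
  rw [← h1]
  have h2 : (Kerr.smoothMetric M 0 0).toPseudoRiemannianMetric.ricci ⟨x, hx'⟩ = 0 :=
    Kerr.ricci_smoothMetric_zero_spin M 0 ⟨x, hx'⟩
  rw [h2]
  rfl

/-- The Kerr–Schild components are metric components (smooth, symmetric, nondegenerate) on
`{r > 0}` in the sense of the coordinate calculus (`OpensChart.isMetricOn_repr` for the bundled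
metric `Kerr.smoothMetric`). [folklore] -/
theorem isMetricOn_kerr_bilin (M a : ℝ) :
    MetricCoord.IsMetricOn (Kerr.bilin M a) (Kerr.region a 0 : Set E4) := by
  haveI : Kerr.Facts :=
    ⟨Kerr.isConnected_region_holds, Kerr.contMDiff_bilin_holds, Kerr.contMDiff_timeVector_holds⟩
  exact OpensChart.isMetricOn_repr (g := (Kerr.smoothMetric M a 0).toPseudoRiemannianMetric)
    fun y ↦ Kerr.smoothMetric_val M a 0 y

/-- `D(Λ⁻¹(· − c)) = Λ⁻¹` everywhere (the affine map has constant derivative; cf.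
`KSDecay.hasFDerivAt_poincareInv`). [folklore] -/
theorem fderiv_poincareInv (Λ : lorentzGroup) (c x : E4) :
    fderiv ℝ (poincareInv Λ c) x = ((Λ : E4 ≃L[ℝ] E4).symm : E4 →L[ℝ] E4) := by
  have h : HasFDerivAt (poincareInv Λ c) ((Λ : E4 ≃L[ℝ] E4).symm : E4 →L[ℝ] E4) x := by
    have h1 := (((Λ : E4 ≃L[ℝ] E4).symm : E4 →L[ℝ] E4).hasFDerivAt).comp x
      ((hasFDerivAt_id x).sub_const c)
    rwa [ContinuousLinearMap.comp_id] at h1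
  exact h.fderiv

/-- **The painted summand is a pull-back**: `boostedKerrBilin Λ c M a = (Λ⁻¹(· − c))^* g_{M,a}` in
the sense of `MetricCoord.pullMetric` (Kerr–Schild 1965: Lorentz covariance of the ansatz).
[folklore] -/
theorem pullMetric_kerr_bilin_poincareInv (Λ : lorentzGroup) (c : E4) (M a : ℝ) :
    MetricCoord.pullMetric (Kerr.bilin M a) (poincareInv Λ c) = boostedKerrBilin Λ c M a := by
  funext x
  ext v w
  rw [MetricCoord.pullMetric_apply, fderiv_poincareInv, boostedKerrBilin_apply]
  rfl

/-- The affine map `x ↦ Λ⁻¹(x − c)` is a change of coordinates from the painted region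
`{r(Λ⁻¹(x − c)) > 0}` onto `{r > 0}` (smooth, into, invertible derivative). [folklore] -/
theorem isCoordChangeOn_poincareInv (Λ : lorentzGroup) (c : E4) (a : ℝ) :
    MetricCoord.IsCoordChangeOn (poincareInv Λ c)
      (poincareInv Λ c ⁻¹' (Kerr.region a 0 : Set E4)) (Kerr.region a 0 : Set E4) where
  isOpen := (Kerr.region a 0).isOpen.preimage (continuous_poincareInv Λ c)
  contDiffOn := (contDiff_poincareInv Λ c).contDiffOn
  mapsTo := fun _ hx ↦ hx
  isInvertible := fun x _ ↦ by
    rw [fderiv_poincareInv]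
    exact ⟨(Λ : E4 ≃L[ℝ] E4).symm, rfl⟩

/-- **Every stationary painted Schwarzschild summand is Ricci-flat in the lab chart**:
`ricAt (boostedKerrBilin Λ c M 0) x = 0` wherever the rest-frame radius is positive
(`ricAt_pullMetric` + `ricAt_kerr_bilin_zero_spin`). [folklore] -/
theorem ricAt_boostedKerrBilin_zero_spin (Λ : lorentzGroup) (c : E4) (M : ℝ) {x : E4}
    (hx : 0 < Kerr.radius 0 (poincareInv Λ c x)) (Y Z : E4) :
    MetricCoord.ricAt (boostedKerrBilin Λ c M 0) x Y Z = 0 := by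
  have hx' : x ∈ poincareInv Λ c ⁻¹' (Kerr.region 0 0 : Set E4) := by
    show poincareInv Λ c x ∈ (Kerr.region 0 0 : Set E4)
    rw [SetLike.mem_coe, Kerr.mem_region, max_self]
    exact hx
  rw [← pullMetric_kerr_bilin_poincareInv,
    ricAt_pullMetric (isMetricOn_kerr_bilin M 0) (isCoordChangeOn_poincareInv Λ c 0) hx' Y Z]
  exact ricAt_kerr_bilin_zero_spin M hx _ _

/-- **Zero slaving error ⇒ `Ric = 0` (Schwarzschild holes).** The crux's summand painted with a
CONSTANT Lorentz map `Λ` and the INERTIAL centre `ξ(s) = ξ₀ + (s − s₀) v(Λ)`,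
`v(Λ) = (Λe₀)~/(Λe₀)⁰` — i.e. with vanishing slaving jets `u̇ = 0`, `ξ̇ − v(Λ) = 0` — is, as a
field on `E4`, the stationary boosted Kerr–Schild field (`boostedKerrBilin_inertialCentre`) and
therefore has vanishing coordinate Ricci form wherever its painted radius is positive. This is the
exact zero set of the slaving mechanism; its converse with rates is the open `SLAVED³` statement.
[folklore] -/
theorem ricAt_inertialSummand_zero_spin (Λ : lorentzGroup) (s₀ : ℝ) (ξ₀ : E3) (M : ℝ) {x : E4}
    (hx : 0 < Kerr.radius 0 (poincareInv Λ (E4.ofTimeSpace s₀ ξ₀) x)) (Y Z : E4) :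
    MetricCoord.ricAt (fun y : E4 ↦ boostedKerrBilin Λ (E4.ofTimeSpace (y 0) (ξ₀ + (y 0 - s₀) •
      ((((Λ : E4 ≃L[ℝ] E4) (E4.basisVector 0)) 0)⁻¹ •
        E4.spatial ((Λ : E4 ≃L[ℝ] E4) (E4.basisVector 0))))) M 0 y) x Y Z = 0 := by
  have h : (fun y : E4 ↦ boostedKerrBilin Λ (E4.ofTimeSpace (y 0) (ξ₀ + (y 0 - s₀) •
      ((((Λ : E4 ≃L[ℝ] E4) (E4.basisVector 0)) 0)⁻¹ •
        E4.spatial ((Λ : E4 ≃L[ℝ] E4) (E4.basisVector 0))))) M 0 y) =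
      boostedKerrBilin Λ (E4.ofTimeSpace s₀ ξ₀) M 0 :=
    funext fun y ↦ boostedKerrBilin_inertialCentre Λ s₀ ξ₀ M 0 (y 0) y
  rw [h]
  exact ricAt_boostedKerrBilin_zero_spin Λ _ M hx Y Z

/-- **Registered sub-goal form** (stub `slaving_ricAt_inertialSummand_zero_spin` of the crux item)
of `ricAt_inertialSummand_zero_spin`: the crux's Schwarzschild summand painted with constant `Λ`
and inertial centre is Ricci-flat in the lab chart. [folklore] -/
theorem slaving_ricAt_inertialSummand_zero_spin : open Literature.Geometry.Lorentzian in ∀ (Λ : lorentzGroup) (s₀ : ℝ) (ξ₀ : E3) (M : ℝ) {x : E4}, 0 < Kerr.radius 0 (poincareInv Λ (E4.ofTimeSpace s₀ ξ₀) x) → ∀ (Y Z : E4), MetricCoord.ricAt (fun y : E4 ↦ boostedKerrBilin Λ (E4.ofTimeSpace (y 0) (ξ₀ + (y 0 - s₀) • ((((Λ : E4 ≃L[ℝ] E4) (E4.basisVector 0)) 0)⁻¹ • E4.spatial ((Λ : E4 ≃L[ℝ] E4) (E4.basisVector 0))))) M 0 y) x Y Z = 0 :=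
  fun Λ s₀ ξ₀ M _ hx Y Z ↦ ricAt_inertialSummand_zero_spin Λ s₀ ξ₀ M hx Y Z

end Summit.FinalStateConjecture.FinalStateConjecture.Theorems.SublinearIsFree.Slaving

end
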